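import Summits.ABC.IUTFork.Cor312SmallStableFrames
import Summits.ABC.IUTFork.Cor312SettingDHVol
import HarnessLib

/-!
# [IUTchIII] Cor. 3.12 — the volume seam of `SmallStableHullSets` at the Dupuy–Hilado-level REAL setting
# (`Real.settingDHVol`, verbatim summandwise container): CLOSED FORM and `hvol` DISCHARGED

PROOF-ONLY support piece of the abc-iut cell (Cor. 3.12 cone, D-0067; ADJUDICATION-SPEC §1 «the assembled real
setting», §2 (G3) REAL-CONTAINER clause; seat abc-iut-w4-d036, gen 2, WAVE-4, home layer L6; the «volume seam» of my
CLAIM on HOME/STATUS 2026-08-26T01:44:51Z, `Setting.ofComparison` twin announced 02:3xZ). TAKES NO SIDE on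
[IUTchIII] Cor. 3.12; 0 `def`s, 0 `Prop` facts.

abc-iut-c312-9's `Cor312SmallStableReal` (p416160/p416818) and abc-iut-c312-10's `Cor312SmallStableHullsReal` reduce
w5-d177's `SmallStableHullSets` at c312-7's `Setting.ofComparison` to named seams, among them the VOLUME seam
`hvol` / clause (iii): "hull-set preimages `e⁻¹((ν a·λ₀)·𝒪_L)` of unboundedly negative log-volume IN THE SITUATION'S
CONTAINER". For the setting of record over the REAL log-shells with the VERBATIM volumes — abc-iut-c312-5's
`Real.settingDHVol` = `Setting.ofComparison` at `Real.situationDHVol` with the field-factor pieces of their `p`-adic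
presentations (`Cor312SettingDHVol`) — the container at a prime `p` is the summandwise one: summands
`X_{v⃗} = K_{v_0} ⊗_{ℚ_p} ⋯ ⊗_{ℚ_p} K_{v_j}` with campaign-S's normalised tensor-packet Haar log-measure `packetLogμ`
(Dupuy–Hilado Def. 3.6.1) and weights `w_{v⃗}` ([IUTchIII] Rmk. 3.1.1 (ii)). THIS FILE computes that container on
hull-set preimages and discharges the seam:

* §1 (over any `PadicPresentation`, abc-iut-c312-5 `Cor312VolumesPadicSummands`): `preimage_hullSet_eq_smul` —
  `ψ_{v⃗}⁻¹(λ·𝒪_L) = ψ_{v⃗}⁻¹(λ)·(R_I)^∼` (the computation inside c312-5's `packetAdm_preimage_hullSet`, exported);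
  `packetLogμ_preimage_hullSet` — **`log μ̄_{v⃗}(ψ_{v⃗}⁻¹(λ·𝒪_L)) = Σ_i (e_i f_i / D_{v⃗})·log ‖λ_i‖`** (campaign-S
  `packetLogμ_smul_normalizedPacket`, [IUTchIV] Prop. 1.4 (iii) / [AbsTopIII] Prop. 5.7 (i)(b): GENUINE Haar modulus);
  `sum_w_packetLogμ_factorMap_preimage_hullSet` — the weighted summandwise log-volume of the field-factor preimage
  `e⁻¹(Π_{(v⃗,i)} λ_{v⃗,i}·𝒪)` in CLOSED FORM `Σ_{(v⃗,i)} W_{v⃗,i}·log ‖λ_{v⃗,i}‖`, `W_{v⃗,i} = w_{v⃗}·e_i f_i / D_{v⃗} ≥ 0`.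
* §2 `hvol_factorMap` — hence, by part 2's container-agnostic `SmallStableFrames.hvol_of_closedForm` with
  `f := log ‖·‖` and the contracting rational `s := p` (`‖p‖ < 1` in every field factor `L_{v⃗,i} ⊇ ℚ_p`): as soon as
  ONE summand `v⃗` has POSITIVE weight and at least one field factor, the `ℚ`-dilates of any hull-set preimage have
  UNBOUNDEDLY NEGATIVE weighted log-volume — c312-9's binder `hvol` / c312-10's clause (iii) in their exact shape,
  from the genuine tensor-packet Haar measures (no model volume).
* §3 the same READ AT `Real.settingDHVol` (`logvol_settingDHVol_preimage_hullSet`, `hvol_settingDHVol`): the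
  container of c312-5's assembled setting IS §1's sum at every prime (`rfl` through `summandPiecesDH` /
  `localPiecesDH` / `toLocalPieces`), the Dupuy–Hilado weights `1/[F:ℚ]^{j+1}` are POSITIVE.
Left for the DH finale (stability seam, owner abc-iut-c312-5 / the A-line: `Cor312VolumesPadicLattice`
`image_latticePk_of_mem_closure` at an odd absolutely unramified `p`, where the log-shell lattice is the unit
polydisc): plug `hvol_settingDHVol` + that stability into c312-9's `smallStableHullSets_ofComparison(_of_descent)` /
c312-10's `ofComparison_smallStableHullSets`. [claim: Mochizuki2012, status: disputed]
[cite: MochizukiAbsTopIII2015, Prop. 5.7 (i)(b) p. 138] [cite: DupuyHilado2025, Def. 3.6.1, §3.7]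
-/

noncomputable section

open Set Function
open scoped Pointwise

namespace Summit.ABC

namespace IUTFork

namespace Cor312Vol

namespace PadicPresentation

open Thm311 Literature.IUT.LogThetaLattice Literature.IUT.LogVolume

variable {T : ThetaIndex} {L : LogShells T} {vQ : T.VQ} {p : ℕ} [Fact p.Prime] (P : PadicPresentation L vQ p)

/-! ## §1. The summandwise container on hull-set preimages, in closed form -/

/-- **`ψ_{v⃗}⁻¹(λ·𝒪_L) = ψ_{v⃗}⁻¹(λ)·(R_I)^∼`** (`λ_i ≠ 0`): the preimage of a hull-set under abc-iut-c312-3's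
decomposition is the multiplicative translate of the normalised packet by `ψ⁻¹(λ)` (the computation inside
c312-5's `packetAdm_preimage_hullSet`). [cite: Mochizuki2012, IUTchIII Rmk. 3.9.5 (ii) p. 127] -/
theorem preimage_hullSet_eq_smul {j : T.Label} (e : T.Caps j → T.Fibre vQ)
    (c : ∀ i : DIdx p (P.kk e), DFac p (P.kk e) i) (hc : ∀ i, c i ≠ 0) :
    dEquiv p (P.kk e) ⁻¹' hullSet (DFac p (P.kk e)) c =
      (dEquiv p (P.kk e)).symm c • (normalizedPacket p (P.kk e) : Set (P.X e)) := by
  haveI : Nonempty (T.Caps j) := ⟨0⟩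
  set g : P.X e := (dEquiv p (P.kk e)).symm c with hg
  have hgc : dEquiv p (P.kk e) g = c := by rw [hg, AlgEquiv.apply_symm_apply]
  rw [← Set.preimage_image_eq (g • (normalizedPacket p (P.kk e) : Set (P.X e))) (dEquiv p (P.kk e)).injective,
    image_smul_eq, image_normalizedPacket_eq_coe, coe_piUnitBallStructure, hgc, hullSet_eq_image_mul _ c hc]

/-- **`log μ̄_{v⃗}(ψ_{v⃗}⁻¹(λ·𝒪_L)) = Σ_i (e_i f_i / D_{v⃗})·log ‖λ_i‖`** — the normalised tensor-packet Haar log-measure of a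
hull-set preimage (campaign-S `packetLogμ_smul_normalizedPacket`: [IUTchIV] Prop. 1.4 (iii) proof / [AbsTopIII]
Prop. 5.7 (i)(b), GENUINE Haar modulus of the field factors). [cite: MochizukiAbsTopIII2015, Prop. 5.7 (i)(b) p. 138] -/
theorem packetLogμ_preimage_hullSet {j : T.Label} (e : T.Caps j → T.Fibre vQ)
    (c : ∀ i : DIdx p (P.kk e), DFac p (P.kk e) i) (hc : ∀ i, c i ≠ 0) :
    packetLogμ p (P.kk e) (dEquiv p (P.kk e) ⁻¹' hullSet (DFac p (P.kk e)) c) =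
      ∑ i, ((packetDegree p (DFac p (P.kk e)) : ℝ))⁻¹ *
        (((absRamificationIdx p (DFac p (P.kk e) i) : ℝ) * residueDegree p (DFac p (P.kk e) i)) *
          Real.log ‖c i‖) := by
  haveI : Nonempty (T.Caps j) := ⟨0⟩
  have hg : ∀ i, dEquiv p (P.kk e) ((dEquiv p (P.kk e)).symm c) i ≠ 0 := fun i => by
    rw [AlgEquiv.apply_symm_apply]; exact hc i
  rw [P.preimage_hullSet_eq_smul e c hc, packetLogμ_smul_normalizedPacket p (P.kk e) _ hg]
  simp only [AlgEquiv.apply_symm_apply]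

/-- The `v⃗`-factor of the field-factor preimage `e⁻¹(Π_{(v⃗,i)} λ_{v⃗,i}·𝒪)` IS `ψ_{v⃗}⁻¹(λ_{v⃗}·𝒪_L)` (comparison onto).
[folklore] -/
theorem factor_factorMap_preimage_hullSet (j : T.Label) (c : ∀ s : P.factorIdx j, P.factorField j s)
    (e : T.Caps j → T.Fibre vQ) :
    (fun y : (∀ e' : T.Caps j → T.Fibre vQ, P.X e') => y e) ''
        (P.comparison j '' ((fun x => P.factorMap j x) ⁻¹' hullSet (P.factorField j) c)) =
      dEquiv p (P.kk e) ⁻¹' hullSet (DFac p (P.kk e)) fun i => c ⟨e, i⟩ := by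
  rw [P.factorMap_preimage_hullSet, Set.image_preimage_eq _ (P.comparison_surjective j),
    Set.eval_image_univ_pi]
  exact Set.univ_pi_nonempty_iff.mpr fun e' => ⟨0, by
    rw [Set.mem_preimage, map_zero]
    exact (mem_polydisc _).mpr fun i => by simp⟩

/-- **The weighted summandwise log-volume of a hull-set preimage, CLOSED FORM**:
`Σ_{v⃗} w_{v⃗}·log μ̄_{v⃗}((e⁻¹(Π λ·𝒪))_{v⃗}) = Σ_{(v⃗,i)} (w_{v⃗}·e_i f_i / D_{v⃗})·log ‖λ_{v⃗,i}‖` — the form in which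
c312-5's verbatim container (`toLocalPieces`, `SummandPieces.ofLocal`) reads hull-set preimages of the field-factor
comparison. [claim: Mochizuki2012, status: disputed] [cite: MochizukiAbsTopIII2015, Prop. 5.7 (i)(b) p. 138] -/
theorem sum_w_packetLogμ_factorMap_preimage_hullSet (j : T.Label) (c : ∀ s : P.factorIdx j, P.factorField j s)
    (hc : ∀ s, c s ≠ 0) :
    (∑ e : P.toLocalPieces.E j, P.toLocalPieces.w j e * P.toLocalPieces.logμ j e
        ((fun y : (∀ e' : P.toLocalPieces.E j, P.toLocalPieces.X j e') => y e) ''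
          (P.toLocalPieces.e j '' ((fun x => P.factorMap j x) ⁻¹' hullSet (P.factorField j) c)))) =
      ∑ e : P.toLocalPieces.E j, ∑ i : DIdx p (P.kk e), (P.w j e * (((packetDegree p (DFac p (P.kk e)) : ℝ))⁻¹ *
        ((absRamificationIdx p (DFac p (P.kk e) i) : ℝ) * residueDegree p (DFac p (P.kk e) i)))) *
          Real.log ‖c ⟨e, i⟩‖ := by
  classical
  refine Finset.sum_congr rfl fun e _ => ?_
  show P.w j e * packetLogμ p (P.kk e) ((fun y : (∀ e' : T.Caps j → T.Fibre vQ, P.X e') => y e) ''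
      (P.comparison j '' ((fun x => P.factorMap j x) ⁻¹' hullSet (P.factorField j) c))) = _
  rw [P.factor_factorMap_preimage_hullSet j c e, P.packetLogμ_preimage_hullSet e _ (fun i => hc ⟨e, i⟩),
    Finset.mul_sum]
  refine Finset.sum_congr rfl fun i _ => ?_
  ring

/-! ## §2. The volume seam at the field-factor comparison of a `p`-adic presentation -/

/-- `‖p‖ < 1` in every field factor `L_{v⃗,i}` (a normed `ℚ_p`-algebra: `‖p‖ = ‖p‖_{ℚ_p} = p⁻¹`). [folklore] -/
theorem norm_ratCast_p_lt_one {j : T.Label} (s : P.factorIdx j) : ‖((p : ℚ) : P.factorField j s)‖ < 1 := by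
  have h : ((p : ℚ) : P.factorField j s) = algebraMap ℚ_[p] (P.factorField j s) (p : ℚ_[p]) := by
    rw [map_natCast, Rat.cast_natCast]
  rw [h, norm_algebraMap']
  exact Padic.norm_p_lt_one

/-- **The volume seam `hvol` DISCHARGED at the field-factor comparison** (c312-9's binder in
`smallStableHullSets_ofComparison(_of_descent)`, c312-10's clause (iii), with `ν a := (a : L_{v⃗,i})_{(v⃗,i)}`): as soon
as one summand `v⃗₀` has positive weight and a field factor, the rational dilates of ANY hull-set preimage have
unboundedly negative weighted summandwise log-volume — from the GENUINE tensor-packet Haar measures (§1) via part 2's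
`SmallStableFrames.hvol_of_closedForm` with `f := log ‖·‖`, `s := p`. [claim: Mochizuki2012, status: disputed]
[cite: MochizukiAbsTopIII2015, Prop. 5.7 (i)(b) p. 138] -/
theorem hvol_factorMap (j : T.Label) (c₀ : ∀ s : P.factorIdx j, P.factorField j s) (hc₀ : ∀ s, c₀ s ≠ 0)
    (s₀ : P.factorIdx j) (hw : 0 < P.w j s₀.1) :
    ∀ c : ℝ, ∃ a : ℚ, a ≠ 0 ∧
      (∑ e : P.toLocalPieces.E j, P.toLocalPieces.w j e * P.toLocalPieces.logμ j e
        ((fun y : (∀ e' : P.toLocalPieces.E j, P.toLocalPieces.X j e') => y e) ''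
          (P.toLocalPieces.e j '' ((fun x => P.factorMap j x) ⁻¹' hullSet (P.factorField j)
            (fun s => ((a : ℚ) : P.factorField j s) * c₀ s))))) < c := by
  classical
  letI hCF : Fintype (T.Caps j → T.Fibre vQ) := P.toLocalPieces.instFintype j
  letI hFin : Fintype (P.factorIdx j) :=
    inferInstanceAs (Fintype (Σ e : T.Caps j → T.Fibre vQ, DIdx p (P.kk e)))
  haveI : ∀ s : P.factorIdx j, CharZero (P.factorField j s) := fun s =>
    charZero_of_injective_algebraMap (algebraMap ℚ_[p] (P.factorField j s)).injective
  -- the closed form, summed over the field-factor index `(v⃗, i)`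
  have hclosed : ∀ c : ∀ s : P.factorIdx j, P.factorField j s, (∀ s, c s ≠ 0) →
      (∑ e : P.toLocalPieces.E j, P.toLocalPieces.w j e * P.toLocalPieces.logμ j e
        ((fun y : (∀ e' : P.toLocalPieces.E j, P.toLocalPieces.X j e') => y e) ''
          (P.toLocalPieces.e j '' ((fun x => P.factorMap j x) ⁻¹' hullSet (P.factorField j) c)))) =
      ∑ s : P.factorIdx j, (P.w j s.1 * (((packetDegree p (DFac p (P.kk s.1)) : ℝ))⁻¹ *
        ((absRamificationIdx p (DFac p (P.kk s.1) s.2) : ℝ) * residueDegree p (DFac p (P.kk s.1) s.2)))) *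
          Real.log ‖c s‖ := fun c hc => by
    rw [P.sum_w_packetLogμ_factorMap_preimage_hullSet j c hc]
    exact (Fintype.sum_sigma (fun s : P.factorIdx j => (P.w j s.1 * (((packetDegree p (DFac p (P.kk s.1)) : ℝ))⁻¹ *
        ((absRamificationIdx p (DFac p (P.kk s.1) s.2) : ℝ) * residueDegree p (DFac p (P.kk s.1) s.2)))) *
          Real.log ‖c s‖)).symm
  refine SmallStableFrames.hvol_of_closedForm (fun x => P.factorMap j x)
    (fun A => ∑ e : P.toLocalPieces.E j, P.toLocalPieces.w j e * P.toLocalPieces.logμ j e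
      ((fun y : (∀ e' : P.toLocalPieces.E j, P.toLocalPieces.X j e') => y e) '' (P.toLocalPieces.e j '' A)))
    (fun s : P.factorIdx j => P.w j s.1 * (((packetDegree p (DFac p (P.kk s.1)) : ℝ))⁻¹ *
      ((absRamificationIdx p (DFac p (P.kk s.1) s.2) : ℝ) * residueDegree p (DFac p (P.kk s.1) s.2))))
    (fun s x => Real.log ‖x‖) hclosed
    (fun s x y hx hy => by simp only [norm_mul, Real.log_mul (norm_ne_zero_iff.mpr hx) (norm_ne_zero_iff.mpr hy)])
    c₀ hc₀ (fun (a : ℚ) (s : P.factorIdx j) => ((a : ℚ) : P.factorField j s)) (fun s => Rat.cast_one)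
    (fun a b s => Rat.cast_mul a b) (p : ℚ) (by exact_mod_cast (Fact.out : p.Prime).ne_zero) ?_
  -- the weighted log-modulus of `p` is negative: all terms ≤ 0, the one at `s₀` is < 0
  have hWnn : ∀ s : P.factorIdx j, 0 ≤ P.w j s.1 * (((packetDegree p (DFac p (P.kk s.1)) : ℝ))⁻¹ *
      ((absRamificationIdx p (DFac p (P.kk s.1) s.2) : ℝ) * residueDegree p (DFac p (P.kk s.1) s.2))) :=
    fun s => mul_nonneg (P.w_nonneg j s.1) (by positivity)
  have hlog : ∀ s : P.factorIdx j, Real.log ‖((p : ℚ) : P.factorField j s)‖ < 0 := fun s =>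
    Real.log_neg (norm_pos_iff.mpr (by exact_mod_cast (Fact.out : p.Prime).ne_zero)) (P.norm_ratCast_p_lt_one s)
  refine sum_mul_neg_of_nonpos_of_exists_neg hWnn (fun s => (hlog s).le) ⟨s₀, ?_, hlog s₀⟩
  refine mul_pos hw (mul_pos (inv_pos.mpr ?_) (mul_pos ?_ ?_))
  · exact_mod_cast packetDegree_pos p (DFac p (P.kk s₀.1))
  · exact_mod_cast absRamificationIdx_pos p (DFac p (P.kk s₀.1) s₀.2)
  · exact_mod_cast residueDegree_pos p (DFac p (P.kk s₀.1) s₀.2)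

end PadicPresentation

end Cor312Vol

/-! ## §3. Read at c312-5's assembled setting `Real.settingDHVol` -/

namespace Thm311

namespace Real

open Cor312 Cor312Vol Literature.IUT.LogThetaLattice Literature.IUT.LogVolume

variable {F : Type} [Field F] [NumberField F] (X : PilotData F) {logv : PadicLogs F} (hlog : LogvAnalytic logv)
  (M : Type) [Field M] [NumberField M]
  (archPk : ∀ (j : (thetaIndex X).Label) (vQ : (thetaIndex X).VQ), Set ((logShellsDH X logv).Packet j vQ))
  (archSub : ∀ (j : (thetaIndex X).Label) (v : (thetaIndex X).V),
    Set ((logShellsDH X logv).Packet j ((thetaIndex X).over v)))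
  (Ψ : ℤ → ∀ v : (thetaIndex X).V, v ∈ (thetaIndex X).Vbad → Set ((logShellsDH X logv).StarPacket v))
  (act : ℤ → ∀ v : (thetaIndex X).V, v ∈ (thetaIndex X).Vbad →
    (logShellsDH X logv).StarPacket v → Module.End ℚ ((logShellsDH X logv).StarPacket v))
  (Mmod : ℤ → ∀ j : (thetaIndex X).LabelStar, Set ((logShellsDH X logv).GlobalPacket j.1))
  (region : ℤ → ∀ j : (thetaIndex X).LabelStar, FinDivisor M → ∀ vQ : (thetaIndex X).VQ,
    Set ((logShellsDH X logv).Packet j.1 vQ))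
  (n : ℤ)

/-- **The verbatim container of `Real.situationDHVol` on hull-set preimages at a prime, CLOSED FORM**: the
mono-analytic log-volume of `e⁻¹(Π_{(v⃗,i)} λ_{v⃗,i}·𝒪)` (the field-factor comparison `factorMapDH` of c312-5's
`Cor312SettingDHVol`) is `Σ_{v⃗} Σ_i (w_{v⃗}·e_i f_i/D_{v⃗})·log ‖λ_{v⃗,i}‖`, `w_{v⃗} = [F:ℚ]^{−(j+1)}` — by `rfl` through
`summandPiecesDH`/`localPiecesDH`/`toLocalPieces` and §1. [claim: Mochizuki2012, status: disputed]
[cite: MochizukiAbsTopIII2015, Prop. 5.7 (i)(b) p. 138] -/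
theorem logvol_situationDHVol_preimage_hullSet (pp : Nat.Primes) (j : (thetaIndex X).Label)
    (c : ∀ s : factorIdxDH X hlog j (.inr pp), factorFieldDH X hlog j (.inr pp) s) (hc : ∀ s, c s ≠ 0) :
    haveI : Fact (pp : ℕ).Prime := ⟨pp.2⟩
    ((situationDHVol X hlog M archPk archSub Ψ act Mmod region).D n).logvol j (.inr pp)
        (factorMapDH X hlog j (.inr pp) ⁻¹' hullSet (factorFieldDH X hlog j (.inr pp)) c) =
      ∑ e : (presAt X hlog pp).toLocalPieces.E j, ∑ i : DIdx (pp : ℕ) ((presAt X hlog pp).kk e),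
        ((presAt X hlog pp).w j e * (((packetDegree (pp : ℕ) (DFac (pp : ℕ) ((presAt X hlog pp).kk e)) : ℝ))⁻¹ *
          ((absRamificationIdx (pp : ℕ) (DFac (pp : ℕ) ((presAt X hlog pp).kk e) i) : ℝ) *
            residueDegree (pp : ℕ) (DFac (pp : ℕ) ((presAt X hlog pp).kk e) i)))) * Real.log ‖c ⟨e, i⟩‖ := by
  haveI : Fact (pp : ℕ).Prime := ⟨pp.2⟩
  exact (presAt X hlog pp).sum_w_packetLogμ_factorMap_preimage_hullSet j c hc

/-- **The volume seam `hvol` DISCHARGED at `Real.settingDHVol`** (c312-9's binder / c312-10's clause (iii) at the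
assembled setting over the REAL log-shells with the VERBATIM volumes): at EVERY prime `p` and label `j`, the
`ℚ`-dilates `(a·λ₀)·𝒪` of every hull-set of the field-factor packet have preimages of UNBOUNDEDLY NEGATIVE mono-analytic
log-volume in the situation's container — from the genuine tensor-packet Haar measures and the positive Dupuy–Hilado
weights `1/[F:ℚ]^{j+1}`; `ν a := (a : L_{v⃗,i})_{(v⃗,i)}`. [claim: Mochizuki2012, status: disputed]
[cite: MochizukiAbsTopIII2015, Prop. 5.7 (i)(b) p. 138] -/
theorem hvol_situationDHVol (pp : Nat.Primes) (j : (thetaIndex X).Label)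
    (c₀ : ∀ s : factorIdxDH X hlog j (.inr pp), factorFieldDH X hlog j (.inr pp) s) (hc₀ : ∀ s, c₀ s ≠ 0) :
    ∀ c : ℝ, ∃ a : ℚ, a ≠ 0 ∧
      ((situationDHVol X hlog M archPk archSub Ψ act Mmod region).D n).logvol j (.inr pp)
        (factorMapDH X hlog j (.inr pp) ⁻¹' hullSet (factorFieldDH X hlog j (.inr pp))
          (fun s => ((a : ℚ) : factorFieldDH X hlog j (.inr pp) s) * c₀ s)) < c := by
  haveI : Fact (pp : ℕ).Prime := ⟨pp.2⟩
  -- one field factor of one summand, where the weight `[F:ℚ]^{−(j+1)}` is positive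
  haveI : Nonempty ((thetaIndex X).Caps j → (thetaIndex X).Fibre (.inr pp)) := inferInstance
  obtain ⟨e₀⟩ := (inferInstance : Nonempty ((thetaIndex X).Caps j → (thetaIndex X).Fibre (.inr pp)))
  obtain ⟨i₀⟩ := (inferInstance : Nonempty (DIdx (pp : ℕ) ((presAt X hlog pp).kk e₀)))
  have hw : 0 < (presAt X hlog pp).w j e₀ := by
    show 0 < weightDH X j
    unfold weightDH
    have h : (0 : ℝ) < Module.finrank ℚ F := by exact_mod_cast Module.finrank_pos
    positivity
  exact (presAt X hlog pp).hvol_factorMap j c₀ hc₀ ⟨e₀, i₀⟩ hw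

end Real

end Thm311

end IUTFork

end Summit.ABC

end
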